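import Literature.NumberTheory.EllipticCurves.Rank1Residual.GVParityTwistTransportProofs
import Literature.NumberTheory.EllipticCurves.Rank1Residual.GVParityLineTypeProofs
import Literature.NumberTheory.GaloisRepresentations.ModPCyclotomicCharacterTotallyRealProofs
import HarnessLib

/-!
# The quadratic character of a `±1`-point of `E(ℚ̄)` through its coordinates:
# `x(P) ∈ ℚ` and `Γ_ℚ` acts on `P` through `χ_d`, `d = (2y + a₁x + a₃)² = 4x³ + b₂x² + 2b₄x + b₆`

HONEST FRAMING (cell `b2b-bsdres-*`, verbatim): the goal of the cell is to DELETE the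
COMBINATION-SHAPED residual classes for ALL analytic-rank ≤ 1 curves over ℚ — "full BSD formula
for every rank ≤ 1 curve in class C" assembled STRICTLY from published theorems — so that the
rank-≤1 remainder becomes exactly the CONSTRUCTION-SHAPED classes, which are TYPED (missing-input
Props), NOT attempted; this is not "finishing BSD". Off-peak literature typer `b2b-bsdres-lit-cgls`
(CGLS22 / GV00, the reducible = Eisenstein column), session 11: an ELEMENTARY REDUCTION of the
Eisenstein column at `p = 3` (classes X1@3, X2@3 = 95 % of the reducible census cells), theorems
only — no definition, no named fact, nothing booked, no label changed.

This is file 1 of 3 (`EisensteinKernelCharacter` → `EisensteinKernelDiscriminant` →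
`EisensteinKernelDiscriminantType`). Content (all [folklore]; Silverman *AEC* III.2.3 (negation
formula `−(x, y) = (x, −y − a₁x − a₃)`), III.§1 (`b₂ = a₁² + 4a₂`, `b₄ = 2a₄ + a₁a₃`, `b₆ = a₃² + 4a₆`,
so `(2y + a₁x + a₃)² = 4x³ + b₂x² + 2b₄x + b₆` on the curve), VIII.§1 (Galois descent
`ℚ̄^Γ = ℚ`), X.§5 (quadratic twists)):

* `smul_eq_iff` — coordinates of `σP` and of `−P` for a geometric point `P = (x, y)`:
  `σP = P ↔ (σx = x ∧ σy = y)`, `σP = −P ↔ (σx = x ∧ σy = −y − a₁x − a₃)`;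
* `exists_disc` — **the quadratic character of a `±1`-point**: if `2P ≠ O` and every `σ ∈ Γ_ℚ`
  acts by `σP = ±P`, then `x(P) = x₀ ∈ ℚ`, `d := 4x₀³ + b₂x₀² + 2b₄x₀ + b₆ ≠ 0`, and
  `σP = P ↔ σ√d = √d` (the tree's `geomSqrt d`);
* `exists_squarefree_mul_sq` — every `d ∈ ℚˣ` is `D · s²` with `D` a SQUAREFREE INTEGER, `s ∈ ℚˣ`;
  `smul_geomSqrt_iff_of_eq_mul_sq` — square classes have the same fixers;
  `exists_eq_mul_sq_of_forall_iff` — conversely, same fixers ⇒ same square class (`√a√b ∈ ℚ`).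

Used by file 2 to attach a squarefree KERNEL DISCRIMINANT `D` to every quadratic rational line
`Φ ≤ E[p]` (every rational line at `p = 3`), and by file 3 to read the Greenberg–Vatsal parity type
of the classes X1@3 / X2@3 off `sign D` and `3 ∣ D`.

References: J. H. Silverman, *The Arithmetic of Elliptic Curves*, GTM 106 (2009), III.2.3, III.§1,
VIII.§1, X.5.4 [SilvermanAEC2009]; HOME/b2b-bsdres-lit-cgls/CGLS-GV-TYPING.md §18.
-/

set_option autoImplicit false

noncomputable section

open scoped Classical NumberField

open WeierstrassCurve Literature.NumberTheory.EllipticCurves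
  Literature.NumberTheory.EllipticCurves.Rank1Residual Field IsDedekindDomain

namespace Summit.BirchSwinnertonDyer.Rank1Residual

namespace KernelDisc

variable {W : WeierstrassCurve ℚ}

/-! ### §1. Coordinates of `σ • P` and `-P`; the quadratic character through `(2y + a₁x + a₃)²` -/

/-- An element of `ℚ̄` fixed by `Γ_ℚ` is rational. [folklore] -/
theorem exists_eq_algebraMap_of_forall_smul_eq {z : (AlgebraicClosure ℚ)}
    (hz : ∀ σ : absoluteGaloisGroup ℚ, σ • z = z) : ∃ q : ℚ, algebraMap ℚ (AlgebraicClosure ℚ) q = z :=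
  Literature.NumberTheory.GaloisRepresentations.mem_range_algebraMap_of_forall_smul_eq ℚ hz

/-- Unfolding the Galois action on a geometric point. [folklore] -/
theorem smul_point_def (σ : absoluteGaloisGroup ℚ) (P : W.geomPoints) :
    σ • P = Affine.Point.map (absoluteGaloisGroup.toAlgEquiv ℚ σ).toAlgHom P := rfl

/-- `Γ_ℚ` fixes the base-changed coefficients and every rational scalar. [folklore] -/
theorem smul_algebraMap (σ : absoluteGaloisGroup ℚ) (q : ℚ) :
    σ • algebraMap ℚ (AlgebraicClosure ℚ) q = algebraMap ℚ (AlgebraicClosure ℚ) q :=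
  (absoluteGaloisGroup.toAlgEquiv ℚ σ).commutes q

/-- **Coordinates of `σP` and `−P`.** For an affine geometric point `P = (x, y)`:
`σP = P ↔ σx = x ∧ σy = y`, and `σP = −P ↔ σx = x ∧ σy = −y − a₁x − a₃`. [folklore] -/
theorem smul_eq_iff (σ : absoluteGaloisGroup ℚ) {P : W.geomPoints} {x y : (AlgebraicClosure ℚ)}
    {h : (W.baseChange (AlgebraicClosure ℚ)).toAffine.Nonsingular x y} (hP : P = Affine.Point.some x y h) :
    (σ • P = P ↔ σ • x = x ∧ σ • y = y) ∧
    (σ • P = -P ↔ σ • x = x ∧ σ • y = -y - (W.baseChange (AlgebraicClosure ℚ)).a₁ * x - (W.baseChange (AlgebraicClosure ℚ)).a₃) := by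
  subst hP
  constructor
  · constructor
    · intro hσ
      have hσ' : (Affine.Point.map (absoluteGaloisGroup.toAlgEquiv ℚ σ).toAlgHom
          (Affine.Point.some x y h) : (W.baseChange (AlgebraicClosure ℚ)).toAffine.Point) = Affine.Point.some x y h := hσ
      rw [Affine.Point.map_some, Affine.Point.some.injEq] at hσ'
      exact hσ'
    · rintro ⟨hx, hy⟩
      change (Affine.Point.map (absoluteGaloisGroup.toAlgEquiv ℚ σ).toAlgHom
          (Affine.Point.some x y h) : (W.baseChange (AlgebraicClosure ℚ)).toAffine.Point) = Affine.Point.some x y h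
      rw [Affine.Point.map_some]
      simp only [Affine.Point.some.injEq]
      exact ⟨hx, hy⟩
  · constructor
    · intro hσ
      have hσ' : (Affine.Point.map (absoluteGaloisGroup.toAlgEquiv ℚ σ).toAlgHom
          (Affine.Point.some x y h) : (W.baseChange (AlgebraicClosure ℚ)).toAffine.Point) = -Affine.Point.some x y h := hσ
      rw [Affine.Point.map_some, Affine.Point.neg_some, Affine.Point.some.injEq] at hσ'
      exact ⟨hσ'.1, hσ'.2⟩
    · rintro ⟨hx, hy⟩
      change (Affine.Point.map (absoluteGaloisGroup.toAlgEquiv ℚ σ).toAlgHom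
          (Affine.Point.some x y h) : (W.baseChange (AlgebraicClosure ℚ)).toAffine.Point) = -Affine.Point.some x y h
      rw [Affine.Point.map_some, Affine.Point.neg_some]
      simp only [Affine.Point.some.injEq]
      exact ⟨hx, hy⟩

/-- An affine geometric point: `P ≠ O` is `(x, y)` for some nonsingular `(x, y)`. [folklore] -/
theorem exists_eq_some {P : W.geomPoints} (hP : P ≠ 0) :
    ∃ (x y : (AlgebraicClosure ℚ)) (h : (W.baseChange (AlgebraicClosure ℚ)).toAffine.Nonsingular x y), P = Affine.Point.some x y h := by
  have aux : ∀ Q : (W.baseChange (AlgebraicClosure ℚ)).toAffine.Point, Q ≠ 0 →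
      ∃ (x y : (AlgebraicClosure ℚ)) (h : (W.baseChange (AlgebraicClosure ℚ)).toAffine.Nonsingular x y), Q = Affine.Point.some x y h := by
    rintro (_ | ⟨x, y, h⟩) hQ
    · exact absurd rfl hQ
    · exact ⟨x, y, h, rfl⟩
  exact aux P hP

/-- `(2y + a₁x + a₃)² = 4x³ + b₂x² + 2b₄x + b₆` on the curve. [folklore] -/
theorem sq_eq_twoTorsionPolynomial {R : Type*} [CommRing R] (V : WeierstrassCurve R) {x y : R}
    (h : V.toAffine.Equation x y) :
    (2 * y + V.a₁ * x + V.a₃) ^ 2 = 4 * x ^ 3 + V.b₂ * x ^ 2 + 2 * V.b₄ * x + V.b₆ := by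
  rw [Affine.equation_iff] at h
  simp only [WeierstrassCurve.b₂, WeierstrassCurve.b₄, WeierstrassCurve.b₆]
  linear_combination 4 * h

/-- **The quadratic character of a `±1`-point through its coordinates.** Let `P = (x, y) ∈ E(ℚ̄)`
with `2P ≠ O` and `σP = ±P` for every `σ ∈ Γ_ℚ`. Then `x = x₀ ∈ ℚ`, the rational number
`d := 4x₀³ + b₂x₀² + 2b₄x₀ + b₆ = (2y + a₁x₀ + a₃)²` is non-zero, and for every `σ`:
`σP = P ↔ σ√d = √d` — `Γ_ℚ` acts on `P` through the quadratic character of `ℚ(√d)`. [folklore] -/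
theorem exists_disc (P : W.geomPoints) (h2 : 2 • P ≠ 0)
    (hq : ∀ σ : absoluteGaloisGroup ℚ, σ • P = P ∨ σ • P = -P) :
    ∃ (x₀ : ℚ) (y : (AlgebraicClosure ℚ)) (h : (W.baseChange (AlgebraicClosure ℚ)).toAffine.Nonsingular (algebraMap ℚ (AlgebraicClosure ℚ) x₀) y),
      P = Affine.Point.some (algebraMap ℚ (AlgebraicClosure ℚ) x₀) y h ∧
      4 * x₀ ^ 3 + W.b₂ * x₀ ^ 2 + 2 * W.b₄ * x₀ + W.b₆ ≠ 0 ∧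
      ∀ σ : absoluteGaloisGroup ℚ, σ • P = P ↔
        σ • geomSqrt (4 * x₀ ^ 3 + W.b₂ * x₀ ^ 2 + 2 * W.b₄ * x₀ + W.b₆) =
          geomSqrt (4 * x₀ ^ 3 + W.b₂ * x₀ ^ 2 + 2 * W.b₄ * x₀ + W.b₆) := by
  have hP0 : P ≠ 0 := fun h ↦ h2 (by rw [h, smul_zero])
  obtain ⟨x, y, h, hP⟩ := exists_eq_some hP0
  -- `x` is rational
  have hx : ∀ σ : absoluteGaloisGroup ℚ, σ • x = x := fun σ ↦ by
    rcases hq σ with hσ | hσ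
    · exact (((smul_eq_iff σ hP).1).mp hσ).1
    · exact (((smul_eq_iff σ hP).2).mp hσ).1
  obtain ⟨x₀, rfl⟩ := exists_eq_algebraMap_of_forall_smul_eq hx
  -- the quantity `y' = 2y + a₁x + a₃` and its square `d`
  set A₁ : (AlgebraicClosure ℚ) := (W.baseChange (AlgebraicClosure ℚ)).a₁ with hA₁
  set A₃ : (AlgebraicClosure ℚ) := (W.baseChange (AlgebraicClosure ℚ)).a₃ with hA₃
  set y' : (AlgebraicClosure ℚ) := 2 * y + A₁ * algebraMap ℚ (AlgebraicClosure ℚ) x₀ + A₃ with hy'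
  set d : ℚ := 4 * x₀ ^ 3 + W.b₂ * x₀ ^ 2 + 2 * W.b₄ * x₀ + W.b₆ with hd
  have hσA₁ : ∀ σ : absoluteGaloisGroup ℚ, σ • A₁ = A₁ := fun σ ↦ smul_algebraMap σ W.a₁
  have hσA₃ : ∀ σ : absoluteGaloisGroup ℚ, σ • A₃ = A₃ := fun σ ↦ smul_algebraMap σ W.a₃
  have hσ2 : ∀ σ : absoluteGaloisGroup ℚ, σ • (2 : (AlgebraicClosure ℚ)) = 2 := fun σ ↦ by
    rw [show (2 : (AlgebraicClosure ℚ)) = algebraMap ℚ (AlgebraicClosure ℚ) 2 by norm_num]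
    exact smul_algebraMap σ 2
  have hfix : ∀ σ : absoluteGaloisGroup ℚ, σ • P = P → σ • y' = y' := by
    intro σ hσ
    obtain ⟨hxσ, hyσ⟩ := ((smul_eq_iff σ hP).1).mp hσ
    simp only [hy', smul_add, smul_mul', hxσ, hyσ, hσA₁, hσA₃, hσ2]
  have hneg : ∀ σ : absoluteGaloisGroup ℚ, σ • P = -P → σ • y' = -y' := by
    intro σ hσ
    obtain ⟨hxσ, hyσ⟩ := ((smul_eq_iff σ hP).2).mp hσ
    simp only [hy', smul_add, smul_mul', hxσ, hyσ, hσA₁, hσA₃, hσ2]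
    ring
  -- `y' ≠ 0` since `2P ≠ O`
  have hy'0 : y' ≠ 0 := by
    intro h0
    apply h2
    have hnegP : (1 : absoluteGaloisGroup ℚ) • P = -P := by
      refine ((smul_eq_iff 1 hP).2).mpr ⟨one_smul _ _, ?_⟩
      rw [one_smul]
      have : 2 * y + A₁ * algebraMap ℚ (AlgebraicClosure ℚ) x₀ + A₃ = 0 := h0
      linear_combination this
    rw [one_smul] at hnegP
    rw [two_smul]
    nth_rewrite 2 [hnegP]
    exact add_neg_cancel P
  -- `y'² = d`
  have hsq : y' ^ 2 = algebraMap ℚ (AlgebraicClosure ℚ) d := by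
    have heq : (W.baseChange (AlgebraicClosure ℚ)).toAffine.Equation (algebraMap ℚ (AlgebraicClosure ℚ) x₀) y := h.1
    have h1 := sq_eq_twoTorsionPolynomial (W.baseChange (AlgebraicClosure ℚ)) heq
    rw [hy', h1, hd]
    -- the base-changed `bᵢ` are the images of `W.bᵢ` (instance-robust: `exact`, not `rw`)
    have hb₂ : algebraMap ℚ (AlgebraicClosure ℚ) W.b₂ = (W.baseChange (AlgebraicClosure ℚ)).b₂ := (W.map_b₂ _).symm
    have hb₄ : algebraMap ℚ (AlgebraicClosure ℚ) W.b₄ = (W.baseChange (AlgebraicClosure ℚ)).b₄ := (W.map_b₄ _).symm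
    have hb₆ : algebraMap ℚ (AlgebraicClosure ℚ) W.b₆ = (W.baseChange (AlgebraicClosure ℚ)).b₆ := (W.map_b₆ _).symm
    simp only [map_add, map_mul, map_pow, map_ofNat, hb₂, hb₄, hb₆]
  have hd0 : d ≠ 0 := by
    intro h0
    rw [h0, map_zero] at hsq
    exact hy'0 (pow_eq_zero_iff two_ne_zero |>.mp hsq)
  -- `√d = ± y'`
  have hroot : geomSqrt d = y' ∨ geomSqrt d = -y' :=
    sq_eq_sq_iff_eq_or_eq_neg.mp (by rw [hsq]; exact geomSqrt_sq d)
  refine ⟨x₀, y, h, hP, hd0, fun σ ↦ ⟨fun hσ ↦ ?_, fun hσ ↦ ?_⟩⟩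
  · rcases hroot with hr | hr
    · rw [hr]; exact hfix σ hσ
    · rw [hr, smul_neg, hfix σ hσ]
  · by_contra hne
    have hσ' : σ • P = -P := (hq σ).resolve_left hne
    have hny : σ • y' = -y' := hneg σ hσ'
    have hns : σ • geomSqrt d = -geomSqrt d := by
      rcases hroot with hr | hr
      · rw [hr, hny]
      · rw [hr, smul_neg, hny]
    rw [hns] at hσ
    have h2z : (2 : (AlgebraicClosure ℚ)) * geomSqrt d = 0 := by linear_combination -hσ
    rcases mul_eq_zero.mp h2z with h | h
    · exact two_ne_zero h
    · exact geomSqrt_ne_zero hd0 h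

/-! ### §2. Squarefree integer representative of a rational square class -/

/-- Every non-zero rational is a squarefree integer times a non-zero rational square. [folklore] -/
theorem exists_squarefree_mul_sq (d : ℚ) (hd : d ≠ 0) :
    ∃ (D : ℤ) (s : ℚ), Squarefree D ∧ D ≠ 0 ∧ s ≠ 0 ∧ d = D * s ^ 2 := by
  -- `n := num · den ≠ 0`, `d · den² = n`
  set n : ℤ := d.num * d.den with hn
  have hden : (d.den : ℚ) ≠ 0 := by exact_mod_cast d.den_nz
  have hnum : d.num ≠ 0 := Rat.num_ne_zero.mpr hd
  have hn0 : n ≠ 0 := mul_ne_zero hnum (by exact_mod_cast d.den_nz)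
  have hdn : d * (d.den : ℚ) ^ 2 = (n : ℚ) := by
    rw [hn, Int.cast_mul, Int.cast_natCast, pow_two, ← mul_assoc, Rat.mul_den_eq_num]
  -- squarefree decomposition of `|n|`
  obtain ⟨a, b, -, hb, hab, ha⟩ := Nat.sq_mul_squarefree_of_pos (Int.natAbs_pos.mpr hn0)
  refine ⟨n.sign * a, (b : ℚ) / d.den, ?_, ?_, ?_, ?_⟩
  · -- squarefree
    rw [← Int.squarefree_natAbs, Int.natAbs_mul, Int.natAbs_sign_of_ne_zero hn0, one_mul,
      Int.natAbs_natCast]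
    exact ha
  · exact mul_ne_zero (fun h ↦ hn0 (Int.sign_eq_zero_iff_zero.mp h))
      (by exact_mod_cast (Nat.pos_of_ne_zero (fun h ↦ by
        rw [h, mul_zero] at hab; exact (Int.natAbs_pos.mpr hn0).ne' hab.symm)).ne')
  · exact div_ne_zero (by exact_mod_cast hb.ne') hden
  · -- `d = sign(n)·a·(b/den)²`: multiply by `den²`
    have hnz : (n : ℚ) = (n.sign * a : ℤ) * (b : ℚ) ^ 2 := by
      have h1 : (n : ℤ) = n.sign * (n.natAbs : ℤ) := (Int.sign_mul_natAbs n).symm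
      rw [← hab] at h1
      have h2 : (n : ℚ) = ((n.sign * ((b ^ 2 * a : ℕ) : ℤ) : ℤ) : ℚ) := by exact_mod_cast h1
      rw [h2]
      push_cast
      ring
    field_simp
    rw [pow_two] at hdn
    linear_combination hdn.trans hnz

/-- Square classes have the same quadratic character: if `d = D · s²` with `s ≠ 0` then
`σ√d = √d ↔ σ√D = √D`. [folklore] -/
theorem smul_geomSqrt_iff_of_eq_mul_sq {d D s : ℚ} (hD : D ≠ 0) (hs : s ≠ 0) (h : d = D * s ^ 2)
    (σ : absoluteGaloisGroup ℚ) :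
    σ • geomSqrt d = geomSqrt d ↔ σ • geomSqrt D = geomSqrt D := by
  have hd : d ≠ 0 := by rw [h]; exact mul_ne_zero hD (pow_ne_zero 2 hs)
  -- `√d = ± s √D`
  have hroot : geomSqrt d = algebraMap ℚ (AlgebraicClosure ℚ) s * geomSqrt D ∨
      geomSqrt d = -(algebraMap ℚ (AlgebraicClosure ℚ) s * geomSqrt D) :=
    sq_eq_sq_iff_eq_or_eq_neg.mp (by
      have e1 : geomSqrt d ^ 2 = algebraMap ℚ (AlgebraicClosure ℚ) d := geomSqrt_sq d
      have e2 : geomSqrt D ^ 2 = algebraMap ℚ (AlgebraicClosure ℚ) D := geomSqrt_sq D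
      rw [mul_pow, e1, e2, h, map_mul, map_pow]; ring)
  have hss : σ • algebraMap ℚ (AlgebraicClosure ℚ) s = algebraMap ℚ (AlgebraicClosure ℚ) s := smul_algebraMap σ s
  have hs' : algebraMap ℚ (AlgebraicClosure ℚ) s ≠ 0 := by
    intro h0; exact hs ((map_eq_zero _).mp h0)
  have key : ∀ ε : (AlgebraicClosure ℚ), (ε = 1 ∨ ε = -1) → geomSqrt d = ε * (algebraMap ℚ (AlgebraicClosure ℚ) s * geomSqrt D) →
      (σ • geomSqrt d = geomSqrt d ↔ σ • geomSqrt D = geomSqrt D) := by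
    intro ε hε hr
    have hσε : σ • ε = ε := by
      rcases hε with rfl | rfl
      · exact smul_one σ
      · rw [smul_neg, smul_one]
    have hε0 : ε ≠ 0 := by rcases hε with rfl | rfl <;> norm_num
    constructor
    · intro hfix
      rcases smul_geomSqrt_eq_or σ D with h1 | h1
      · exact h1
      · exfalso
        rw [hr, smul_mul', smul_mul', hσε, hss, h1] at hfix
        have : (2 : (AlgebraicClosure ℚ)) * (ε * (algebraMap ℚ (AlgebraicClosure ℚ) s * geomSqrt D)) = 0 := by
          linear_combination -hfix
        rcases mul_eq_zero.mp this with h | h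
        · exact two_ne_zero h
        · exact mul_ne_zero hε0 (mul_ne_zero hs' (geomSqrt_ne_zero hD)) h
    · intro hfix
      rw [hr, smul_mul', smul_mul', hσε, hss, hfix]
  rcases hroot with hr | hr
  · exact key 1 (Or.inl rfl) (by rw [one_mul]; exact hr)
  · exact key (-1) (Or.inr rfl) (by rw [neg_one_mul]; exact hr)


/-- Same fixers ⇒ same square class: if `σ√a = √a ↔ σ√b = √b` for all `σ`, then `a = b · r²`
for some non-zero rational `r` (`√a·√b` is `Γ_ℚ`-fixed, hence rational). [folklore] -/
theorem exists_eq_mul_sq_of_forall_iff {a b : ℚ} (ha : a ≠ 0) (hb : b ≠ 0)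
    (h : ∀ σ : absoluteGaloisGroup ℚ, σ • geomSqrt a = geomSqrt a ↔ σ • geomSqrt b = geomSqrt b) :
    ∃ r : ℚ, r ≠ 0 ∧ a = b * r ^ 2 := by
  have hfix : ∀ σ : absoluteGaloisGroup ℚ, σ • (geomSqrt a * geomSqrt b) = geomSqrt a * geomSqrt b := by
    intro σ
    rw [smul_mul']
    rcases smul_geomSqrt_eq_or σ a with h1 | h1
    · rw [h1, (h σ).mp h1]
    · have h2 : σ • geomSqrt b = -geomSqrt b := by
        rcases smul_geomSqrt_eq_or σ b with h2 | h2
        · exact absurd ((h σ).mpr h2) (by rw [h1]; exact (geomSqrt_ne_neg ha).symm)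
        · exact h2
      rw [h1, h2]; ring
  obtain ⟨q, hq⟩ := exists_eq_algebraMap_of_forall_smul_eq hfix
  have e1 : geomSqrt a ^ 2 = algebraMap ℚ (AlgebraicClosure ℚ) a := geomSqrt_sq a
  have e2 : geomSqrt b ^ 2 = algebraMap ℚ (AlgebraicClosure ℚ) b := geomSqrt_sq b
  have hq2 : algebraMap ℚ (AlgebraicClosure ℚ) (q ^ 2) = algebraMap ℚ (AlgebraicClosure ℚ) (a * b) := by
    rw [map_pow, hq, mul_pow, e1, e2, ← map_mul]
  have hab : q ^ 2 = a * b := (algebraMap ℚ (AlgebraicClosure ℚ)).injective hq2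
  have hq0 : q ≠ 0 := by
    intro h0; rw [h0, zero_pow two_ne_zero] at hab; exact mul_ne_zero ha hb hab.symm
  refine ⟨q / b, div_ne_zero hq0 hb, ?_⟩
  field_simp
  linear_combination -hab

end KernelDisc

end Summit.BirchSwinnertonDyer.Rank1Residual

end
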